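import Summits.RiemannHypothesis.RiemannHypothesis.Theorems.AsymptoticCriticalLine.Negative.HurwitzShift
import Summits.RiemannHypothesis.RiemannHypothesis.Theorems.AsymptoticCriticalLine.Negative.ShapeFailsMore

/-!
# The two halves of the crux — interior band vs edge — and which `ζ`-like objects break which (negative lemmas, cycle 3)

Pre-emptive target analysis for the crux-ideate card `interior-edge-split` (the only card of round 1
that survived triage, 2 passes of 3): the crux `AsymptoticCriticalLine` (stmt-RiemannHypothesis-2063,
route RuelleBand) splits as `NoInteriorBand ∧ EdgeZeroFreeStrip` (glue `InteriorEdgeSplit`, proved by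
crux-triage r1-2). Here the two halves are typed as ABSTRACT SHAPES of a function `Z`
(`NoInteriorBandShape`, `EdgeZeroFreeShape`; at `Z = riemannZeta` they are the card's statements
verbatim, `noInteriorBand_zeta_iff`, `edgeZeroFree_zeta_iff`), the easy direction
crux-shape ⟹ both halves is proved for every `Z` (`noInterior_of_band`, `edge_of_band`), and the
model zoo of `ShapeFails` / `ShapeFailsMore` is sorted by the half it violates (all unconditional):

* INTERIOR half fails, edge half ⟺ `ζ`'s (open, = route Strip's crux): one non-tempered local factor
  `zetaTwistedAtTwo` (line `3/4`; `not_noInterior_zetaTwistedAtTwo`, `edge_zetaTwistedAtTwo_iff`);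
  width `shiftedZeta a` (lines `1/2 ± a`; `not_noInterior_shiftedZeta`).
* BOTH halves fail: additive objects `swF = L(χ₃) + L(χ₅)` (hence Davenport–Heilbronn, Hurwitz
  `ζ(s,1/5)` by the same Saias–Weingartner theorem) — `≫ T` zeros in EVERY strip
  `1/2 ≤ σ₁ < σ < σ₂ ≤ 1` (`swF_zeros_infinite`, `not_noInterior_swF`, `not_edge_swF`); the other
  values `ζ − a`, `a ≠ 0` (`not_noInterior_zeta_sub_const`, `not_edge_zeta_sub_const`); the
  derivative `ζ'` (`not_noInterior_deriv_zeta`, `not_edge_deriv_zeta`).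
* EDGE half fails, interior half plausible: Beurling systems (DMV 2006 Thm 1: zeros on
  `σ = 1 − a/log t` and none to their right — `ShapeFails.exists_beurling_not_band`; prose only, the
  vendored fact does not record that the heights of those zeros are unbounded).
* EDGE half TRUE, INTERIOR half FALSE, unconditionally — TRUNCATION: the 3-term section
  `ζ₃(s) = 1 + 2^{−s} + 3^{−s}` has infinitely many zeros in every window around the root
  `σ₃ ∈ (1/2, 1)` of `2^{−σ} + 3^{−σ} = 1` (`≈ 0.788`; Bohr's equivalence theorem with the Liouville
  twist + Kronecker + Hurwitz, the tree's `TuranPartialSums` toolkit) and none to the right of `σ₃`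
  (`Truncation.lean`: `zetaPartialSum_three_interior_band`, `not_band_zetaPartialSum_three`; the
  shape corollaries follow at once). The two halves are independent; and the band shape belongs
  to the complete series / infinite product, never to a truncation.

Reading for the lead: the interior half ALONE is already sensitive to every local-exactness input
found for the crux (temperedness of each factor, exact half-density / no width, and — `Scaling.lean` —
exact weights of iterates), and to additivity, value `0`, differentiation; only the Beurling /
integrality input is specific to the edge half. "Different owners" (card) is right; "the interior
half is the soft half" would be wrong.
-/

noncomputable section

namespace Summit.RiemannHypothesis.RiemannHypothesis.Theorems.AsymptoticCriticalLine.Negative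

open Complex Set
open Summit.RiemannHypothesis.RiemannHypothesis.Theses.RuelleBand (AsymptoticCriticalLine)

/-! ## 0. The two halves as abstract shapes -/

/-- The `ε`-window of zeros of `Z` around the abscissa `σ₀` (inside the open strip). [folklore] -/
def windowSet (Z : ℂ → ℂ) (σ₀ ε : ℝ) : Set ℂ :=
  {s : ℂ | Z s = 0 ∧ 0 < s.re ∧ s.re < 1 ∧ |s.re - σ₀| < ε}

/-- NO INTERIOR BAND: no abscissa `σ₀ ∈ (0,1)`, `σ₀ ≠ 1/2`, is approached by the real parts of
infinitely many zeros (card interior-edge-split, `NoInteriorBand`, for general `Z`). [folklore] -/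
def NoInteriorBandShape (Z : ℂ → ℂ) : Prop :=
  ∀ σ₀ : ℝ, 0 < σ₀ → σ₀ < 1 → σ₀ ≠ 1 / 2 → ∃ ε : ℝ, 0 < ε ∧ (windowSet Z σ₀ ε).Finite

/-- EDGE ZERO-FREE STRIP: no zeros with `1 − δ < Re s < 1` (card interior-edge-split,
`EdgeZeroFreeStrip` = route Strip's crux, for general `Z`). [folklore] -/
def EdgeZeroFreeShape (Z : ℂ → ℂ) : Prop :=
  ∃ δ : ℝ, 0 < δ ∧ ∀ s : ℂ, Z s = 0 → 1 - δ < s.re → s.re < 1 → False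

/-- At `Z = ζ` the first shape is the card's `NoInteriorBand`, verbatim. [folklore] -/
theorem noInteriorBand_zeta_iff :
    NoInteriorBandShape riemannZeta ↔
      ∀ σ₀ : ℝ, 0 < σ₀ → σ₀ < 1 → σ₀ ≠ 1 / 2 → ∃ ε : ℝ, 0 < ε ∧
        {s : ℂ | riemannZeta s = 0 ∧ 0 < s.re ∧ s.re < 1 ∧ |s.re - σ₀| < ε}.Finite :=
  Iff.rfl

/-- At `Z = ζ` the second shape is route Strip's crux `∃ δ > 0, QuasiRiemannHypothesis (1 − δ)`
(stmt-RiemannHypothesis-0349), verbatim. [folklore] -/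
theorem edgeZeroFree_zeta_iff :
    EdgeZeroFreeShape riemannZeta ↔
      ∃ δ : ℝ, 0 < δ ∧ Literature.NumberTheory.LFunctions.QuasiRiemannHypothesis (1 - δ) :=
  Iff.rfl

/-! ## 1. The easy direction: the band shape implies both halves (any `Z`) -/

/-- Band shape ⟹ no interior band (window of radius `|σ₀ − 1/2|/2` ⊆ band of that level). [folklore] -/
theorem noInterior_of_band (Z : ℂ → ℂ) (h : ∀ ε : ℝ, 0 < ε → (bandSet Z ε).Finite) :
    NoInteriorBandShape Z := by
  intro σ₀ _ _ hne
  have hpos : 0 < |σ₀ - 1 / 2| / 2 := by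
    have : 0 < |σ₀ - 1 / 2| := abs_pos.2 (sub_ne_zero.2 hne)
    linarith
  refine ⟨|σ₀ - 1 / 2| / 2, hpos, (h _ hpos).subset ?_⟩
  rintro s ⟨hz, h0, h1, hw⟩
  refine ⟨hz, h0, h1, ?_⟩
  have h3 := abs_sub_le σ₀ s.re (1 / 2)
  have h4 : |σ₀ - s.re| = |s.re - σ₀| := abs_sub_comm _ _
  linarith

/-- Band shape ⟹ edge zero-free strip (the finitely many zeros with `Re s ≥ 3/4` have a largest
real part `< 1`; the argument of the route's support `AsymptoticToZeroFreeStrip`). [folklore] -/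
theorem edge_of_band (Z : ℂ → ℂ) (h : ∀ ε : ℝ, 0 < ε → (bandSet Z ε).Finite) :
    EdgeZeroFreeShape Z := by
  by_contra hE
  simp only [EdgeZeroFreeShape, not_exists, not_and, not_forall, not_false_iff] at hE
  have hfin : {s : ℂ | Z s = 0 ∧ 3 / 4 ≤ s.re ∧ s.re < 1}.Finite := by
    refine (h (1 / 4) (by norm_num)).subset ?_
    rintro s ⟨hz, h34, h1⟩
    exact ⟨hz, by linarith, h1, by rw [abs_of_pos (by linarith)]; linarith⟩
  set R : Finset ℝ := hfin.toFinset.image Complex.re with hR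
  by_cases hne : R.Nonempty
  · set M : ℝ := R.max' hne with hM
    have hM1 : M < 1 := by
      have hmem := R.max'_mem hne
      rw [← hM, hR, Finset.mem_image] at hmem
      obtain ⟨s, hs, hsM⟩ := hmem
      rw [← hsM]
      exact (hfin.mem_toFinset.1 hs).2.2
    have hM34 : 3 / 4 ≤ M := by
      obtain ⟨r, hr⟩ := hne
      have hr' := hr
      rw [hR, Finset.mem_image] at hr'
      obtain ⟨s, hs, rfl⟩ := hr'
      exact (hfin.mem_toFinset.1 hs).2.1.trans (R.le_max' _ hr)
    obtain ⟨s, hz, hlo, hhi, -⟩ := hE (1 - M) (by linarith)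
    have hs : s ∈ {s : ℂ | Z s = 0 ∧ 3 / 4 ≤ s.re ∧ s.re < 1} := ⟨hz, by linarith, hhi⟩
    have hle : s.re ≤ M := R.le_max' _ (Finset.mem_image.2 ⟨s, hfin.mem_toFinset.2 hs, rfl⟩)
    linarith
  · obtain ⟨s, hz, hlo, hhi, -⟩ := hE (1 / 4) (by norm_num)
    have hs : s ∈ {s : ℂ | Z s = 0 ∧ 3 / 4 ≤ s.re ∧ s.re < 1} := ⟨hz, by linarith, hhi⟩
    exact hne ⟨s.re, Finset.mem_image.2 ⟨s, hfin.mem_toFinset.2 hs, rfl⟩⟩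

/-- So the crux implies both of its halves (the non-trivial converse, for `ζ`, is the card's glue
`InteriorEdgeSplit`, Bolzano–Weierstrass on the real parts; proved by crux-triage r1-2). [folklore] -/
theorem halves_of_acl (hacl : AsymptoticCriticalLine) :
    NoInteriorBandShape riemannZeta ∧ EdgeZeroFreeShape riemannZeta :=
  ⟨noInterior_of_band _ (acl_iff_bandSet.1 hacl), edge_of_band _ (acl_iff_bandSet.1 hacl)⟩

/-! ## 2. Generic killers of each half -/

/-- A set containing arbitrarily large finite subsets is infinite. [folklore] -/
theorem infinite_of_finset_card_gt {S : Set ℂ}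
    (h : ∀ N : ℕ, ∃ F : Finset ℂ, (∀ s ∈ F, s ∈ S) ∧ N < F.card) : S.Infinite := by
  intro hfin
  obtain ⟨F, hF, hN⟩ := h hfin.toFinset.card
  exact (lt_irrefl _) (hN.trans_le (Finset.card_le_card fun s hs => hfin.mem_toFinset.2 (hF s hs)))

/-- A populated vertical line `Re s = σ₀`, `σ₀ ∈ (0,1) ∖ {1/2}`, kills the interior half. [folklore] -/
theorem not_noInterior_of_line {Z : ℂ → ℂ} {σ₀ : ℝ} (h0 : 0 < σ₀) (h1 : σ₀ < 1) (hne : σ₀ ≠ 1 / 2)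
    (hinf : {t : ℝ | Z ((σ₀ : ℂ) + t * I) = 0}.Infinite) : ¬ NoInteriorBandShape Z := by
  intro h
  obtain ⟨ε, hε, hfin⟩ := h σ₀ h0 h1 hne
  have hsub : (fun t : ℝ => (σ₀ : ℂ) + t * I) '' {t : ℝ | Z ((σ₀ : ℂ) + t * I) = 0}
      ⊆ windowSet Z σ₀ ε := by
    rintro _ ⟨t, ht, rfl⟩
    refine ⟨ht, ?_, ?_, ?_⟩ <;>
      simp only [add_re, ofReal_re, mul_re, I_re, mul_zero, ofReal_im, I_im, mul_one, sub_self,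
        add_zero, abs_zero] <;> assumption
  have hinj : Set.InjOn (fun t : ℝ => (σ₀ : ℂ) + t * I) {t : ℝ | Z ((σ₀ : ℂ) + t * I) = 0} := by
    intro a _ b _ hab
    have h' := congrArg Complex.im hab
    simpa using h'
  exact (hinf.image hinj).mono hsub hfin

/-- Infinitely many zeros in EVERY open strip `1/2 < σ₁ < σ < σ₂ < 1` kill the interior half …
[folklore] -/
theorem not_noInterior_of_strips {Z : ℂ → ℂ}
    (h : ∀ σ₁ σ₂ : ℝ, 1 / 2 < σ₁ → σ₁ < σ₂ → σ₂ < 1 →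
      {s : ℂ | Z s = 0 ∧ σ₁ < s.re ∧ s.re < σ₂}.Infinite) :
    ¬ NoInteriorBandShape Z := by
  intro hN
  obtain ⟨ε, hε, hfin⟩ := hN (3 / 4) (by norm_num) (by norm_num) (by norm_num)
  have hε' : 0 < min ε (1 / 8) := lt_min hε (by norm_num)
  have hε8 : min ε (1 / 8) ≤ 1 / 8 := min_le_right _ _
  have hεε : min ε (1 / 8) ≤ ε := min_le_left _ _
  refine h (3 / 4 - min ε (1 / 8)) (3 / 4 + min ε (1 / 8)) (by linarith) (by linarith) (by linarith)
    (hfin.subset ?_)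
  rintro s ⟨hz, hlo, hhi⟩
  exact ⟨hz, by linarith, by linarith, abs_sub_lt_iff.2 ⟨by linarith, by linarith⟩⟩

/-- … and the edge half. [folklore] -/
theorem not_edge_of_strips {Z : ℂ → ℂ}
    (h : ∀ σ₁ σ₂ : ℝ, 1 / 2 < σ₁ → σ₁ < σ₂ → σ₂ < 1 →
      {s : ℂ | Z s = 0 ∧ σ₁ < s.re ∧ s.re < σ₂}.Infinite) :
    ¬ EdgeZeroFreeShape Z := by
  rintro ⟨δ, hδ, hE⟩
  have hδ' : 0 < min δ (1 / 4) := lt_min hδ (by norm_num)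
  have hδ4 : min δ (1 / 4) ≤ 1 / 4 := min_le_right _ _
  have hδδ : min δ (1 / 4) ≤ δ := min_le_left _ _
  obtain ⟨s, hz, hlo, hhi⟩ := (h (1 - min δ (1 / 4) / 2) (1 - min δ (1 / 4) / 4) (by linarith)
    (by linarith) (by linarith)).nonempty
  exact hE s hz (by linarith) (by linarith)

/-! ## 3. Interior half fails, edge half is `ζ`'s: one rough factor; width -/

/-- `(1 − 2^{3/4−s}) = 0` forces `Re s = 3/4`. [folklore] -/
theorem re_eq_of_twist_eq_zero {s : ℂ} (h : 1 - (2 : ℂ) ^ ((3 : ℂ) / 4 - s) = 0) : s.re = 3 / 4 := by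
  have h1 : (2 : ℂ) ^ ((3 : ℂ) / 4 - s) = 1 := (sub_eq_zero.1 h).symm
  have h2 : ‖(2 : ℂ) ^ ((3 : ℂ) / 4 - s)‖ = (2 : ℝ) ^ ((3 : ℂ) / 4 - s).re := by
    rw [show (2 : ℂ) = ((2 : ℝ) : ℂ) by norm_num]
    exact Complex.norm_cpow_eq_rpow_re_of_pos two_pos _
  rw [h1, norm_one] at h2
  have h3 : ((3 : ℂ) / 4 - s).re = 0 := by
    have := congrArg (Real.logb 2) h2
    rw [Real.logb_one, Real.logb_rpow two_pos (by norm_num)] at this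
    exact this.symm
  have h4 : ((3 : ℂ) / 4 - s).re = 3 / 4 - s.re := by simp [sub_re]
  linarith

/-- INTERIOR HALF FAILS for `ζ` with one non-tempered local factor (`ShapeFails.zetaTwistedAtTwo`):
the line `Re s = 3/4` is populated. [folklore] -/
theorem not_noInterior_zetaTwistedAtTwo : ¬ NoInteriorBandShape zetaTwistedAtTwo := by
  refine not_noInterior_of_line (σ₀ := 3 / 4) (by norm_num) (by norm_num) (by norm_num) ?_
  have hsub : Set.range (fun k : ℕ => (2 * Real.pi / Real.log 2 * k : ℝ))
      ⊆ {t : ℝ | zetaTwistedAtTwo (((3 / 4 : ℝ) : ℂ) + t * I) = 0} := by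
    rintro _ ⟨k, rfl⟩
    exact zetaTwistedAtTwo_secondBandPt k
  have hinj : Function.Injective (fun k : ℕ => (2 * Real.pi / Real.log 2 * k : ℝ)) := by
    intro a b hab
    have hc : (2 * Real.pi / Real.log 2 : ℝ) ≠ 0 :=
      div_ne_zero (by positivity) (Real.log_pos one_lt_two).ne'
    exact_mod_cast mul_left_cancel₀ hc hab
  exact (Set.infinite_range_of_injective hinj).mono hsub

/-- … while its EDGE HALF is exactly `ζ`'s (the modified factor vanishes only on `Re s = 3/4`):
open, = route Strip's crux. Conditionally on that crux, `zetaTwistedAtTwo` realises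
"edge half true, interior half false". [folklore] -/
theorem edge_zetaTwistedAtTwo_iff : EdgeZeroFreeShape zetaTwistedAtTwo ↔ EdgeZeroFreeShape riemannZeta := by
  constructor
  · rintro ⟨δ, hδ, h⟩
    exact ⟨δ, hδ, fun s hz hlo hhi => h s (by rw [zetaTwistedAtTwo, hz, mul_zero]) hlo hhi⟩
  · rintro ⟨δ, hδ, h⟩
    refine ⟨min δ (1 / 4), lt_min hδ (by norm_num), fun s hz hlo hhi => ?_⟩
    rcases mul_eq_zero.1 hz with h1 | h1
    · have := re_eq_of_twist_eq_zero h1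
      have : min δ (1 / 4) ≤ 1 / 4 := min_le_right _ _
      linarith
    · exact h s h1 (by linarith [min_le_left δ (1 / 4)]) hhi

section shifted

open Literature.Barriers.RiemannHypothesis.RamanujanAxiom

/-- INTERIOR HALF FAILS for the width-`2a` object `G_a = ζ(s−a)ζ(s+a)`, `0 < a < 1/2`
(`ShapeFailsMore.not_band_shiftedZeta`): the line `Re s = 1/2 + a` is populated (Hardy). [folklore] -/
theorem not_noInterior_shiftedZeta {a : ℝ} (ha0 : 0 < a) (ha : a < 1 / 2) :
    ¬ NoInteriorBandShape (shiftedZeta a) := by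
  refine not_noInterior_of_line (σ₀ := 1 / 2 + a) (by linarith) (by linarith) (by linarith) ?_
  have hinf := (shiftedZeta_zeros_infinite a).1
  have heq : (((1 / 2 + a : ℝ) : ℂ)) = 1 / 2 + (a : ℂ) := by push_cast; ring
  simpa only [heq] using hinf

end shifted

/-! ## 4. Both halves fail: additive objects, other values, the derivative -/

/-- `swF = L(χ₃) + L(χ₅)` has infinitely many zeros in EVERY strip `1/2 ≤ σ₁ < σ < σ₂ ≤ 1`
(`≥ cT` of height `≤ T`: Saias–Weingartner 2009 Thm 2, PROVED in tree as
`Literature.Barriers.RiemannHypothesis.SaiasWeingartner_holds`). The same holds verbatim for the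
Davenport–Heilbronn function and the Hurwitz zeta function `ζ(s,1/5)` (`DavenportHeilbronnBand`,
`HurwitzShift`: same theorem, other families). [folklore] -/
theorem swF_zeros_infinite {σ₁ σ₂ : ℝ} (h1 : 1 / 2 ≤ σ₁) (h12 : σ₁ < σ₂) (h2 : σ₂ ≤ 1) :
    {s : ℂ | swF s = 0 ∧ σ₁ < s.re ∧ s.re < σ₂}.Infinite := by
  obtain ⟨η, hη, hstrip⟩ :=
    Literature.Barriers.RiemannHypothesis.SaiasWeingartner_holds Bool swLevel swChar
      (fun _ => LSeries.delta) (by simp) swChar_isPrimitive swSigma_injective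
      (fun _ => ⟨support_delta_finite, 1, one_ne_zero, by simp [LSeries.delta]⟩)
  obtain ⟨c, hc, T₀, hT⟩ := hstrip σ₁ σ₂ h1 h12 (by linarith)
  refine infinite_of_finset_card_gt fun N => ?_
  obtain ⟨Z, hZcard, hZ⟩ := hT (max T₀ (((N : ℝ) + 1) / c)) (le_max_left _ _)
  refine ⟨Z, fun s hs => ?_, ?_⟩
  · obtain ⟨hs1, hs2, _, h4⟩ := hZ s hs
    simp only [Fintype.sum_bool, LSeries_delta, Pi.one_apply, one_mul] at h4
    refine ⟨?_, hs1, hs2⟩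
    unfold swF
    linear_combination h4
  · have hge : (N : ℝ) + 1 ≤ c * max T₀ (((N : ℝ) + 1) / c) :=
      calc (N : ℝ) + 1 = c * (((N : ℝ) + 1) / c) := by field_simp
        _ ≤ c * max T₀ (((N : ℝ) + 1) / c) := by gcongr; exact le_max_right _ _
    exact_mod_cast (show (N : ℝ) < Z.card by linarith)

/-- BOTH HALVES FAIL for `swF`: interior … [folklore] -/
theorem not_noInterior_swF : ¬ NoInteriorBandShape swF :=
  not_noInterior_of_strips fun _ _ h1 h12 h2 => swF_zeros_infinite h1.le h12 h2.le

/-- … and edge. [folklore] -/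
theorem not_edge_swF : ¬ EdgeZeroFreeShape swF :=
  not_edge_of_strips fun _ _ h1 h12 h2 => swF_zeros_infinite h1.le h12 h2.le

/-- The other values: `ζ − a`, `a ≠ 0`, has infinitely many zeros in every strip
`1/2 < σ₁ < σ < σ₂ < 1` (Titchmarsh §11.10, PROVED in tree as `Titchmarsh1986_aPoints_holds`).
[folklore] -/
theorem zeta_sub_const_zeros_infinite {a : ℂ} (ha : a ≠ 0) {σ₁ σ₂ : ℝ} (h1 : 1 / 2 < σ₁)
    (h12 : σ₁ < σ₂) (h2 : σ₂ < 1) :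
    {s : ℂ | riemannZeta s - a = 0 ∧ σ₁ < s.re ∧ s.re < σ₂}.Infinite := by
  obtain ⟨K, hK, T₀, hT⟩ :=
    Literature.Barriers.RiemannHypothesis.Titchmarsh1986_aPoints_holds a ha σ₁ σ₂ h1 h12 h2
  refine infinite_of_finset_card_gt fun N => ?_
  obtain ⟨F, hF, hcard⟩ := hT (max (T₀ + 1) (((N : ℝ) + 1) / K))
    (lt_of_lt_of_le (by linarith) (le_max_left _ _))
  refine ⟨F, fun ρ hρ => ?_, ?_⟩
  · obtain ⟨hr1, hr2, -, -, h5⟩ := hF ρ hρ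
    exact ⟨by rw [h5, sub_self], hr1, hr2⟩
  · have hge : (N : ℝ) + 1 ≤ K * max (T₀ + 1) (((N : ℝ) + 1) / K) :=
      calc (N : ℝ) + 1 = K * (((N : ℝ) + 1) / K) := by field_simp
        _ ≤ K * max (T₀ + 1) (((N : ℝ) + 1) / K) := by gcongr; exact le_max_right _ _
    exact_mod_cast (show (N : ℝ) < F.card by linarith)

/-- BOTH HALVES FAIL for `ζ − a`, `a ≠ 0`. [folklore] -/
theorem not_noInterior_zeta_sub_const {a : ℂ} (ha : a ≠ 0) :
    ¬ NoInteriorBandShape (fun s => riemannZeta s - a) :=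
  not_noInterior_of_strips fun _ _ h1 h12 h2 => zeta_sub_const_zeros_infinite ha h1 h12 h2

/-- [folklore] -/
theorem not_edge_zeta_sub_const {a : ℂ} (ha : a ≠ 0) :
    ¬ EdgeZeroFreeShape (fun s => riemannZeta s - a) :=
  not_edge_of_strips fun _ _ h1 h12 h2 => zeta_sub_const_zeros_infinite ha h1 h12 h2

/-- BOTH HALVES FAIL for `ζ'` (`ShapeFailsMore.deriv_zeta_zeros_infinite`: Voronin universality +
Cauchy + Rouché, all in tree). [folklore] -/
theorem not_noInterior_deriv_zeta : ¬ NoInteriorBandShape (deriv riemannZeta) :=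
  not_noInterior_of_strips fun _ _ h1 h12 h2 => deriv_zeta_zeros_infinite h1 h12 h2

/-- [folklore] -/
theorem not_edge_deriv_zeta : ¬ EdgeZeroFreeShape (deriv riemannZeta) :=
  not_edge_of_strips fun _ _ h1 h12 h2 => deriv_zeta_zeros_infinite h1 h12 h2

end Summit.RiemannHypothesis.RiemannHypothesis.Theorems.AsymptoticCriticalLine.Negative
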